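import Literature.Analysis.FunctionSpaces.SobolevTracePoincareProofs
import Literature.Analysis.FunctionSpaces.TorusPeriodization
import HarnessLib

/-!
# Lattice cells of `ℝ^d`, the partition of the fundamental cube, and the Poincaré inequality on
a cell

Trunk: Sobolev (`Literature/Analysis/FunctionSpaces`). Elementary geometric-measure tools for
(quasi-)self-similar constructions on the torus, where functions are patched from rescaled
blocks on the squares of a tiling (Alberti–Crippa–Mazzucato 2019, Def. 7: the tiling `𝒯_λ` of
`T²` / of the unit square into `λ⁻²` squares of side `λ`, `λ⁻¹ ∈ ℕ`; Bruè–De Lellis 2023, §4: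
the family `𝒬(λ)`):

* `Torus.latticeCell m κ` — the half-open cube `∏ᵢ [κᵢ/m, (κᵢ+1)/m)` of the lattice
  `m⁻¹ℤ^d ⊂ ℝ^d` (`κ ∈ ℤ^d`), its interior `Torus.latticeCellInterior` (the open squares of
  the sources), their common volume `m^{-d}` (so the two restricted Lebesgue measures agree,
  `Torus.restrict_latticeCell_eq`), convexity and diameter `≤ √d/m` of the open cell;
* the **partition of the fundamental cube** `[0,1)^d = ⋃_{0 ≤ κ < m} Q_κ`
  (`Torus.unitCube_eq_iUnion_latticeCell`, union over `κ : d → Fin m`, pairwise disjoint), and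
  the resulting splitting of (Bochner and Lebesgue) integrals over `[0,1)^d` into cells;
* the **Poincaré inequality on a cell** for `C¹` functions `u : ℝ^d → F`,
  `‖u - ⨍_Q u‖_{L²(Q)} ≤ (√d/m) 2^{d/2} ‖Du‖_{L²(Q)}` (`Torus.eLpNorm_sub_setAverage_latticeCell_le`),
  a corollary of the two-point estimate on convex sets and the averaging lemma of
  `SobolevTracePoincareProofs` (Maz'ya 1985, §1.1.10–1.1.11).

Half-open cells are used for the partition (they tile `[0,1)^d` exactly, matching the accepted
fundamental cube `Torus.unitCube`), open cells for the Poincaré inequality (the two-point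
estimate wants an open convex set); the boundaries are null.

## References

* G. Alberti, G. Crippa, A. L. Mazzucato, *Exponential self-similar mixing by incompressible
  flows*, J. Amer. Math. Soc. 32 (2019), 445–490, Def. 7, §3.2, §6.2.
* E. Bruè, C. De Lellis, *Anomalous dissipation for the forced 3D Navier–Stokes equations*,
  Comm. Math. Phys. 400 (2023), §4 (the tilings `𝒬(λ)`).
* V. G. Maz'ya, *Sobolev Spaces* (Springer, 1985), §1.1.10–1.1.11.
-/

noncomputable section

open MeasureTheory Set Filter Finset
open scoped ENNReal NNReal Topology

namespace Literature.Analysis.FunctionSpaces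

namespace Torus

variable {d : Type*} [Fintype d]

/-! ## Lattice cells -/

section Cells

/-- The half-open lattice cell `Q_κ = ∏ᵢ [κᵢ/m, (κᵢ+1)/m) ⊂ ℝ^d` of mesh `m⁻¹` with lower
corner `κ/m`, `κ ∈ ℤ^d` (Alberti–Crippa–Mazzucato 2019, Def. 7: the tiling `𝒯_λ`, `λ = m⁻¹`,
there and in Bruè–De Lellis 2023, §4 (`𝒬(λ)`) with open squares — the boundaries are
Lebesgue-null, `volume_latticeCell`/`volume_latticeCellInterior`). [cite: AlbertiCrippaMazzucato2019, Def. 7] -/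
def latticeCell (m : ℕ) (κ : d → ℤ) : Set (EuclideanSpace ℝ d) :=
  {y | ∀ i, y i ∈ Ico ((κ i : ℝ) / m) ((κ i + 1 : ℝ) / m)}

/-- The open lattice cell `∏ᵢ (κᵢ/m, (κᵢ+1)/m)` (the interior of `latticeCell m κ` for `m ≥ 1`;
Bruè–De Lellis 2023, §4, the open squares of `𝒬(λ)`). [cite: BrueDeLellisCMP2023, §4] -/
def latticeCellInterior (m : ℕ) (κ : d → ℤ) : Set (EuclideanSpace ℝ d) :=
  {y | ∀ i, y i ∈ Ioo ((κ i : ℝ) / m) ((κ i + 1 : ℝ) / m)}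

variable {m : ℕ} {κ : d → ℤ}

omit [Fintype d] in
/-- Membership in a lattice cell. [folklore] -/
@[simp]
theorem mem_latticeCell {y : EuclideanSpace ℝ d} :
    y ∈ latticeCell m κ ↔ ∀ i, y i ∈ Ico ((κ i : ℝ) / m) ((κ i + 1 : ℝ) / m) :=
  Iff.rfl

omit [Fintype d] in
/-- Membership in an open lattice cell. [folklore] -/
@[simp]
theorem mem_latticeCellInterior {y : EuclideanSpace ℝ d} :
    y ∈ latticeCellInterior m κ ↔ ∀ i, y i ∈ Ioo ((κ i : ℝ) / m) ((κ i + 1 : ℝ) / m) :=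
  Iff.rfl

omit [Fintype d] in
/-- The open cell is contained in the half-open cell. [folklore] -/
theorem latticeCellInterior_subset : latticeCellInterior m κ ⊆ latticeCell (d := d) m κ :=
  fun _ hy i => Ioo_subset_Ico_self (hy i)

omit [Fintype d] in
/-- A lattice cell as the preimage of a box of `ℝ^d = d → ℝ` under `WithLp.ofLp`. [folklore] -/
theorem latticeCell_eq_preimage : latticeCell (d := d) m κ =
    WithLp.ofLp ⁻¹' Set.pi univ fun i => Ico ((κ i : ℝ) / m) ((κ i + 1 : ℝ) / m) := by
  ext y; simp [latticeCell]

omit [Fintype d] in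
/-- An open lattice cell as the preimage of an open box under `WithLp.ofLp`. [folklore] -/
theorem latticeCellInterior_eq_preimage : latticeCellInterior (d := d) m κ =
    WithLp.ofLp ⁻¹' Set.pi univ fun i => Ioo ((κ i : ℝ) / m) ((κ i + 1 : ℝ) / m) := by
  ext y; simp [latticeCellInterior]

/-- Lattice cells are measurable. [folklore] -/
theorem measurableSet_latticeCell : MeasurableSet (latticeCell (d := d) m κ) := by
  rw [latticeCell_eq_preimage]
  exact (MeasurableSet.univ_pi fun _ => measurableSet_Ico).preimage (WithLp.measurable_ofLp _ _)

/-- Open lattice cells are open. [folklore] -/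
theorem isOpen_latticeCellInterior : IsOpen (latticeCellInterior (d := d) m κ) := by
  rw [latticeCellInterior_eq_preimage]
  exact (isOpen_set_pi finite_univ fun _ _ => isOpen_Ioo).preimage (PiLp.continuous_ofLp 2 _)

/-- Open lattice cells are measurable. [folklore] -/
theorem measurableSet_latticeCellInterior : MeasurableSet (latticeCellInterior (d := d) m κ) :=
  isOpen_latticeCellInterior.measurableSet

/-- The volume of a half-open lattice cell of mesh `m⁻¹` is `m^{-d}`. [folklore] -/
theorem volume_latticeCell (hm : 0 < m) :
    volume (latticeCell (d := d) m κ) = ENNReal.ofReal ((m : ℝ)⁻¹) ^ Fintype.card d := by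
  rw [latticeCell_eq_preimage, (PiLp.volume_preserving_ofLp d).measure_preimage
    (MeasurableSet.univ_pi fun _ => measurableSet_Ico).nullMeasurableSet, Real.volume_pi_Ico]
  have h : ∀ i, ((κ i : ℝ) + 1) / m - (κ i : ℝ) / m = (m : ℝ)⁻¹ := fun i => by
    have hm' : (m : ℝ) ≠ 0 := by exact_mod_cast hm.ne'
    field_simp; ring
  simp only [h, Finset.prod_const, Finset.card_univ]

/-- The volume of an open lattice cell of mesh `m⁻¹` is `m^{-d}`. [folklore] -/
theorem volume_latticeCellInterior (hm : 0 < m) :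
    volume (latticeCellInterior (d := d) m κ) = ENNReal.ofReal ((m : ℝ)⁻¹) ^ Fintype.card d := by
  rw [latticeCellInterior_eq_preimage, (PiLp.volume_preserving_ofLp d).measure_preimage
    (MeasurableSet.univ_pi fun _ => measurableSet_Ioo).nullMeasurableSet, Real.volume_pi_Ioo]
  have h : ∀ i, ((κ i : ℝ) + 1) / m - (κ i : ℝ) / m = (m : ℝ)⁻¹ := fun i => by
    have hm' : (m : ℝ) ≠ 0 := by exact_mod_cast hm.ne'
    field_simp; ring
  simp only [h, Finset.prod_const, Finset.card_univ]

/-- Lattice cells have positive finite volume (`m ≥ 1`). [folklore] -/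
theorem volume_latticeCellInterior_ne_zero (hm : 0 < m) :
    volume (latticeCellInterior (d := d) m κ) ≠ 0 := by
  rw [volume_latticeCellInterior hm]
  exact pow_ne_zero _ (by simp [hm])

/-- Lattice cells have finite volume. [folklore] -/
theorem volume_latticeCell_ne_top (hm : 0 < m) : volume (latticeCell (d := d) m κ) ≠ ∞ := by
  rw [volume_latticeCell hm]
  exact ENNReal.pow_ne_top ENNReal.ofReal_ne_top

/-- The half-open and the open cell differ by a null set: the two restricted Lebesgue measures
coincide. [folklore] -/
theorem restrict_latticeCell_eq (hm : 0 < m) :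
    (volume : Measure (EuclideanSpace ℝ d)).restrict (latticeCell m κ) =
      volume.restrict (latticeCellInterior m κ) := by
  refine (Measure.restrict_congr_set ?_).symm
  refine ae_eq_of_subset_of_measure_ge latticeCellInterior_subset ?_
    measurableSet_latticeCellInterior.nullMeasurableSet (volume_latticeCell_ne_top hm)
  rw [volume_latticeCell hm, volume_latticeCellInterior hm]

omit [Fintype d] in
/-- Open lattice cells are convex. [folklore] -/
theorem convex_latticeCellInterior : Convex ℝ (latticeCellInterior (d := d) m κ) := by
  have : latticeCellInterior (d := d) m κ =
      ⋂ i, (EuclideanSpace.proj i : EuclideanSpace ℝ d →L[ℝ] ℝ) ⁻¹'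
        Ioo ((κ i : ℝ) / m) ((κ i + 1 : ℝ) / m) := by
    ext y; simp [latticeCellInterior]
  rw [this]
  exact convex_iInter fun i => (convex_Ioo _ _).linear_preimage _

/-- Two points of an open cell of mesh `m⁻¹` are at distance at most `√d / m`. [folklore] -/
theorem norm_sub_le_of_mem_latticeCellInterior (hm : 0 < m) {x y : EuclideanSpace ℝ d}
    (hx : x ∈ latticeCellInterior m κ) (hy : y ∈ latticeCellInterior m κ) :
    ‖y - x‖ ≤ Real.sqrt (Fintype.card d) / m := by
  have hm' : (0 : ℝ) < m := by exact_mod_cast hm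
  have hcoord : ∀ i, (y - x) i ^ 2 ≤ ((m : ℝ)⁻¹) ^ 2 := by
    intro i
    have hxi := hx i
    have hyi := hy i
    have h1 : |(y - x) i| ≤ (m : ℝ)⁻¹ := by
      rw [abs_le]
      simp only [PiLp.sub_apply]
      constructor
      · have := hxi.2; have := hyi.1
        rw [inv_eq_one_div]
        have h : ((κ i : ℝ) + 1) / m - (κ i : ℝ) / m = 1 / m := by field_simp; ring
        linarith
      · have := hxi.1; have := hyi.2
        rw [inv_eq_one_div]
        have h : ((κ i : ℝ) + 1) / m - (κ i : ℝ) / m = 1 / m := by field_simp; ring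
        linarith
    calc (y - x) i ^ 2 = |(y - x) i| ^ 2 := (sq_abs _).symm
      _ ≤ ((m : ℝ)⁻¹) ^ 2 := pow_le_pow_left₀ (abs_nonneg _) h1 2
  rw [EuclideanSpace.norm_eq, div_eq_mul_inv, ← Real.sqrt_sq (inv_nonneg.2 hm'.le),
    ← Real.sqrt_mul (Nat.cast_nonneg _)]
  refine Real.sqrt_le_sqrt ?_
  calc ∑ i, ‖(y - x) i‖ ^ 2 = ∑ i, (y - x) i ^ 2 := by simp [Real.norm_eq_abs, sq_abs]
    _ ≤ ∑ _i : d, ((m : ℝ)⁻¹) ^ 2 := Finset.sum_le_sum fun i _ => hcoord i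
    _ = Fintype.card d * ((m : ℝ)⁻¹) ^ 2 := by simp

omit [Fintype d] in
/-- **Partition of the fundamental cube into lattice cells**: for `m ≥ 1`,
`[0,1)^d = ⋃_{0 ≤ κ < m} Q_κ`, the union over `κ : d → Fin m`. [folklore] -/
theorem unitCube_eq_iUnion_latticeCell (hm : 0 < m) :
    unitCube d = ⋃ κ : d → Fin m, latticeCell m (fun i => ((κ i : ℕ) : ℤ)) := by
  have hm' : (0 : ℝ) < m := by exact_mod_cast hm
  ext y
  simp only [mem_unitCube, mem_iUnion, mem_latticeCell, Int.cast_natCast, Set.mem_Ico]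
  constructor
  · intro hy
    have hfl : ∀ i, 0 ≤ ⌊(m : ℝ) * y i⌋ ∧ ⌊(m : ℝ) * y i⌋ < m := fun i => by
      constructor
      · exact Int.floor_nonneg.2 (mul_nonneg hm'.le (hy i).1)
      · refine Int.floor_lt.2 ?_
        calc (m : ℝ) * y i < m * 1 := mul_lt_mul_of_pos_left (hy i).2 hm'
          _ = ((m : ℤ) : ℝ) := by simp
    refine ⟨fun i => ⟨⌊(m : ℝ) * y i⌋.toNat, ?_⟩, fun i => ?_⟩
    · have := hfl i
      omega
    · have h1 : ((⌊(m : ℝ) * y i⌋.toNat : ℕ) : ℝ) = (⌊(m : ℝ) * y i⌋ : ℝ) := by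
        have : ((⌊(m : ℝ) * y i⌋.toNat : ℕ) : ℤ) = ⌊(m : ℝ) * y i⌋ := Int.toNat_of_nonneg (hfl i).1
        exact_mod_cast this
      rw [h1, div_le_iff₀ hm', lt_div_iff₀ hm', mul_comm (y i)]
      exact ⟨Int.floor_le _, Int.lt_floor_add_one _⟩
  · rintro ⟨κ, hκ⟩ i
    obtain ⟨h1, h2⟩ := hκ i
    constructor
    · exact le_trans (div_nonneg (Nat.cast_nonneg _) hm'.le) h1
    · refine lt_of_lt_of_le h2 ?_
      rw [div_le_one hm']
      have : (κ i : ℕ) + 1 ≤ m := (κ i).isLt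
      exact_mod_cast this

omit [Fintype d] in
/-- Distinct lattice cells of the same mesh are disjoint. [folklore] -/
theorem disjoint_latticeCell (hm : 0 < m) {κ κ' : d → ℤ} (h : κ ≠ κ') :
    Disjoint (latticeCell (d := d) m κ) (latticeCell m κ') := by
  have hm' : (0 : ℝ) < m := by exact_mod_cast hm
  obtain ⟨i, hi⟩ := Function.ne_iff.1 h
  rw [Set.disjoint_left]
  intro y hy hy'
  rw [mem_latticeCell] at hy hy'
  have h1 := hy i
  have h2 := hy' i
  rw [Set.mem_Ico, div_le_iff₀ hm', lt_div_iff₀ hm'] at h1 h2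
  have h3 : (κ i : ℝ) < κ' i + 1 := by linarith
  have h4 : (κ' i : ℝ) < κ i + 1 := by linarith
  have h5 : κ i < κ' i + 1 := by exact_mod_cast h3
  have h6 : κ' i < κ i + 1 := by exact_mod_cast h4
  exact hi (by omega)

omit [Fintype d] in
/-- The cells indexed by `κ : d → Fin m` are pairwise disjoint. [folklore] -/
theorem pairwiseDisjoint_latticeCell (hm : 0 < m) :
    Pairwise (Function.onFun Disjoint fun κ : d → Fin m =>
      latticeCell (d := d) m (fun i => ((κ i : ℕ) : ℤ))) := by
  intro κ κ' h
  refine disjoint_latticeCell hm fun heq => h ?_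
  funext i
  have := congrFun heq i
  exact Fin.ext (by exact_mod_cast this)

/-- **Splitting an integral over the fundamental cube into cells**: for `m ≥ 1` and `g`
integrable on `[0,1)^d`, `∫_{[0,1)^d} g = Σ_κ ∫_{Q_κ} g`. [folklore] -/
theorem setIntegral_unitCube_eq_sum_latticeCell [DecidableEq d] {F : Type*} [NormedAddCommGroup F]
    [NormedSpace ℝ F] (hm : 0 < m) {g : EuclideanSpace ℝ d → F}
    (hg : IntegrableOn g (unitCube d) volume) :
    ∫ y in unitCube d, g y = ∑ κ : d → Fin m, ∫ y in latticeCell m (fun i => ((κ i : ℕ) : ℤ)), g y := by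
  have hU := unitCube_eq_iUnion_latticeCell (d := d) hm
  have : unitCube d = ⋃ κ ∈ (Finset.univ : Finset (d → Fin m)),
      latticeCell m (fun i => ((κ i : ℕ) : ℤ)) := by
    rw [hU]; simp
  rw [this, integral_biUnion_finset _ (fun κ _ => measurableSet_latticeCell)
    (fun κ _ κ' _ h => pairwiseDisjoint_latticeCell hm h)]
  intro κ _
  refine hg.mono_set ?_
  rw [hU]
  exact subset_iUnion (fun κ : d → Fin m => latticeCell m (fun i => ((κ i : ℕ) : ℤ))) κ

/-- **Splitting a Lebesgue integral over the fundamental cube into cells** (`m ≥ 1`). [folklore] -/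
theorem setLIntegral_unitCube_eq_sum_latticeCell [DecidableEq d] (hm : 0 < m)
    (G : EuclideanSpace ℝ d → ℝ≥0∞) :
    ∫⁻ y in unitCube d, G y = ∑ κ : d → Fin m, ∫⁻ y in latticeCell m (fun i => ((κ i : ℕ) : ℤ)), G y := by
  have hU := unitCube_eq_iUnion_latticeCell (d := d) hm
  have : unitCube d = ⋃ κ ∈ (Finset.univ : Finset (d → Fin m)),
      latticeCell m (fun i => ((κ i : ℕ) : ℤ)) := by
    rw [hU]; simp
  rw [this, lintegral_biUnion_finset (fun κ _ κ' _ h => pairwiseDisjoint_latticeCell hm h)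
    (fun κ _ => measurableSet_latticeCell)]

end Cells


/-! ## The Poincaré inequality on a lattice cell -/

section Poincare

variable [Nonempty d] {m : ℕ}
variable {F : Type*} [NormedAddCommGroup F] [NormedSpace ℝ F] [CompleteSpace F]

omit [Nonempty d] in
/-- An open lattice cell lies in the closed ball of radius `√d/m` around any of its points. [folklore] -/
theorem latticeCellInterior_subset_closedBall (hm : 0 < m) {κ : d → ℤ} {y₀ : EuclideanSpace ℝ d}
    (hy₀ : y₀ ∈ latticeCellInterior m κ) :
    latticeCellInterior m κ ⊆ Metric.closedBall y₀ (Real.sqrt (Fintype.card d) / m) :=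
  fun _ hy => by
    rw [Metric.mem_closedBall, dist_eq_norm]
    exact norm_sub_le_of_mem_latticeCellInterior hm hy₀ hy

omit [Nonempty d] [NormedSpace ℝ F] [CompleteSpace F] in
/-- A continuous function is integrable on an open lattice cell (`m ≥ 1`). [folklore] -/
theorem integrableOn_latticeCellInterior (hm : 0 < m) {u : EuclideanSpace ℝ d → F}
    (hu : Continuous u) (κ : d → ℤ) : IntegrableOn u (latticeCellInterior m κ) volume := by
  rcases (latticeCellInterior (d := d) m κ).eq_empty_or_nonempty with h | ⟨y₀, hy₀⟩
  · rw [h]; exact integrableOn_empty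
  · exact (hu.continuousOn.integrableOn_compact (isCompact_closedBall y₀ _)).mono_set
      (latticeCellInterior_subset_closedBall hm hy₀)

/-- **Poincaré inequality on a lattice cell** for `C¹` functions `u : ℝ^d → F`:
`‖u - ⨍_Q u‖_{L²(Q)} ≤ (√d / m) · 2^{d/2} · ‖Du‖_{L²(Q)}` on every open cell `Q` of mesh `m⁻¹`
(Maz'ya 1985, §1.1.11, Lemma, for sets star-shaped with respect to a ball; here the two-point
estimate on the convex cell, `eLpNorm_prod_sub_le_of_contDiff`, diameter `≤ √d/m`, followed by
the averaging lemma `eLpNorm_sub_setAverage_le_of_prod`; the volume factors `μ(Q)^{∓1/2}`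
cancel). [cite: Mazja1985, §1.1.11 Lemma] -/
theorem eLpNorm_sub_setAverage_latticeCell_le (hm : 0 < m) {u : EuclideanSpace ℝ d → F}
    (hu : ContDiff ℝ 1 u) (κ : d → ℤ) :
    eLpNorm (fun y => u y - ⨍ z in latticeCellInterior m κ, u z) 2
        (volume.restrict (latticeCellInterior m κ)) ≤
      ENNReal.ofReal (Real.sqrt (Fintype.card d) / m) * 2 ^ ((Fintype.card d : ℝ) / 2) *
        eLpNorm (_root_.fderiv ℝ u) 2 (volume.restrict (latticeCellInterior m κ)) := by
  set Q := latticeCellInterior (d := d) m κ with hQ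
  have hQo : IsOpen Q := isOpen_latticeCellInterior
  have hQ0 : volume Q ≠ 0 := volume_latticeCellInterior_ne_zero hm
  have hQt : volume Q ≠ ∞ :=
    measure_ne_top_of_subset latticeCellInterior_subset (volume_latticeCell_ne_top hm)
  have hm' : (0 : ℝ) < m := by exact_mod_cast hm
  have hδ : 0 < Real.sqrt (Fintype.card d) / m :=
    div_pos (Real.sqrt_pos.2 (by exact_mod_cast Fintype.card_pos)) hm'
  have hseg : ∀ x ∈ Q, ∀ y ∈ Q, segment ℝ x y ⊆ Q := fun x hx y hy =>
    convex_latticeCellInterior.segment_subset hx hy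
  have hdist : ∀ x ∈ Q, ∀ y ∈ Q, ‖y - x‖ ≤ Real.sqrt (Fintype.card d) / m := fun x hx y hy =>
    norm_sub_le_of_mem_latticeCellInterior hm hx hy
  have huI : IntegrableOn u Q volume := integrableOn_latticeCellInterior hm hu.continuous κ
  have h2pt := eLpNorm_prod_sub_le_of_contDiff (μ := volume) hu hQo hQo.measurableSet subset_rfl
    hseg hδ hdist (p := 2) (by norm_num)
  have havg := eLpNorm_sub_setAverage_le_of_prod (μ := volume) (S := Q) (B := Q) hQ0 hQt huI
    huI.aestronglyMeasurable (p := 2) (by norm_num)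
  have hrank : (Module.finrank ℝ (EuclideanSpace ℝ d) : ℝ) = Fintype.card d := by
    rw [finrank_euclideanSpace]
  simp only [ENNReal.toReal_ofNat, hrank] at h2pt havg
  have hcancel : (volume Q)⁻¹ ^ (1 / 2 : ℝ) * volume Q ^ (1 / 2 : ℝ) = 1 := by
    rw [← ENNReal.mul_rpow_of_nonneg _ _ (by norm_num : (0 : ℝ) ≤ 1 / 2),
      ENNReal.inv_mul_cancel hQ0 hQt, ENNReal.one_rpow]
  calc eLpNorm (fun y => u y - ⨍ z in Q, u z) 2 (volume.restrict Q)
      ≤ (volume Q)⁻¹ ^ (1 / 2 : ℝ) *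
          eLpNorm (fun z : EuclideanSpace ℝ d × EuclideanSpace ℝ d => u z.1 - u z.2) 2
            ((volume.restrict Q).prod (volume.restrict Q)) := havg
    _ ≤ (volume Q)⁻¹ ^ (1 / 2 : ℝ) *
          (ENNReal.ofReal (Real.sqrt (Fintype.card d) / m) * 2 ^ ((Fintype.card d : ℝ) / 2) *
            volume Q ^ (1 / 2 : ℝ) * eLpNorm (_root_.fderiv ℝ u) 2 (volume.restrict Q)) := by
        gcongr
    _ = ENNReal.ofReal (Real.sqrt (Fintype.card d) / m) * 2 ^ ((Fintype.card d : ℝ) / 2) *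
          eLpNorm (_root_.fderiv ℝ u) 2 (volume.restrict Q) *
          ((volume Q)⁻¹ ^ (1 / 2 : ℝ) * volume Q ^ (1 / 2 : ℝ)) := by ring
    _ = _ := by rw [hcancel, mul_one]

end Poincare

/-! ## The fundamental cube: boundedness and integrability -/

section UnitCube

variable [DecidableEq d]

/-- The fundamental cube lies in the closed ball of radius `#d`. [folklore] -/
theorem unitCube_subset_closedBall :
    unitCube d ⊆ Metric.closedBall (0 : EuclideanSpace ℝ d) (Fintype.card d) := fun y hy => by
  simpa using norm_le_card_of_mem_unitCube hy

/-- A continuous function on `ℝ^d` is integrable on the fundamental cube. [folklore] -/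
theorem integrableOn_unitCube_of_continuous {V : Type*} [NormedAddCommGroup V]
    {g : EuclideanSpace ℝ d → V} (hg : Continuous g) : IntegrableOn g (unitCube d) volume :=
  (hg.continuousOn.integrableOn_compact (isCompact_closedBall _ _)).mono_set
    unitCube_subset_closedBall

omit [Fintype d] [DecidableEq d] in
/-- A lattice cell with `0 ≤ κ < m` lies in the fundamental cube. [folklore] -/
theorem latticeCell_subset_unitCube {m : ℕ} (hm : 0 < m) (κ : d → Fin m) :
    latticeCell m (fun i => ((κ i : ℕ) : ℤ)) ⊆ unitCube d := by
  rw [unitCube_eq_iUnion_latticeCell hm]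
  exact subset_iUnion (fun κ : d → Fin m => latticeCell m (fun i => ((κ i : ℕ) : ℤ))) κ

end UnitCube

end Torus

end Literature.Analysis.FunctionSpaces
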